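import Mathlib.Algebra.MonoidAlgebra.Module
import Mathlib.Data.ZMod.Basic
import Mathlib.GroupTheory.Perm.Basic
import Mathlib.LinearAlgebra.Basis.Defs
import Mathlib.LinearAlgebra.Span.Defs
import Literature.NumberTheory.DiophantineGeometry.StandardFillings
import HarnessLib

/-!
# Brundan–Kleshchev / Hu–Mathas / Brundan–Kleshchev–Wang: the graded cellular basis of `𝔽_p S_n`

Topic `Literature/RepresentationTheory/FiniteGroups`. The combinatorics of the `ℤ`-grading of the
group algebra `𝔽_p[S_n]` (Brundan–Kleshchev 2009: `𝔽_p S_n` is the level-one degenerate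
cyclotomic Hecke algebra `H_n^{Λ₀}`, isomorphic to the cyclotomic Khovanov–Lauda–Rouquier algebra
`R_n^{Λ₀}` of type `A^{(1)}_{p-1}`, hence `ℤ`-graded), stated over the tree's standard Young
tableaux `StdFilling n μ.youngDiagram` (`StandardFillings.lean`), and ONE named fact (nothing
asserted, no proof):

* `cellResidue p (r, c) = c - r (mod p)` — the `p`-residue of a cell; `IsAddableNode`,
  `IsRemovableNode`, `addableNodes`, `removableNodes` — addable / removable nodes of a finite set
  of cells (exhaustive: `mem_addableNodes`, `mem_removableNodes`);
* `prefixCells f k`, `tableauDegreeStep p f k`, `tableauDegree p f` — the Brundan–Kleshchev–Wang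
  degree `deg T = ∑_k d_{A_k}(shape T_{≤ k})` of a standard tableau given by its growth sequence
  `f : Fin n → ℕ × ℕ` (`f k` = the cell of the entry `k`; for `T : StdFilling n Y` use `T.1`),
  `d_A(μ) = #{addable res(A)-nodes of μ strictly below A} − #{removable res(A)-nodes of μ strictly
  below A}` ("below" = larger row index, English convention; `μ` includes `A`);
* `residueContent p μ i` — the number of cells of residue `i` of `μ ⊢ n` (the `p`-content, i.e.
  the block label: equal `p`-content ⟺ equal `p`-core ⟺ same `p`-block, Nakayama's conjecture);
* `TableauPair n = Σ μ ⊢ n, Std(μ) × Std(μ)` — same-shape pairs of standard tableaux, the index set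
  of the Murphy / Hu–Mathas cellular bases (`∑_μ (f^μ)² = n!` of them, tree theorems
  `sum_sq_numStandardTableaux` and `numStandardTableaux_eq_card_stdFilling`), with
  `TableauPair.degree p (μ, S, T) = deg S + deg T` and
  `TableauPair.content p (μ, S, T) = content μ`;
* `KLRGradedCellularBasis` — THE NAMED FACT: `𝔽_p[S_n]` has a basis `β` indexed by `TableauPair n`
  with `β_i β_j ∈ span {β_k : content k = content i = content j, degree k = degree i + degree j}`
  (Hu–Mathas 2010, Main Theorem: the homogeneous graded cellular basis `ψ_{ST}`,
  `deg ψ_{ST} = deg S + deg T`, each `ψ_{ST}` lying in the block `e_α H e_α` of its content `α`).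

Sanity values pinning the conventions (`p = 2`, proved by `decide`): the tableau `0 1` of shape
`(2)` has degree `1`, the column `0 / 1` has degree `0` (so `dim_q 𝔽₂S₂ = 1 + q²`, matching
`𝔽₂S₂ = 𝔽₂[y]/(y²)`, `deg y = 2`); of shape `(2,1)`, `0 1 / 2` has degree `1` and `0 2 / 1` has
degree `-1`.

Why only a named fact: the proof needs the Khovanov–Lauda–Rouquier presentation of `𝔽_p S_n`
(Brundan–Kleshchev) and the graded cellularity of the `ψ`-basis (Hu–Mathas), neither of which is
in Mathlib or the tree. Deliberately NOT here: the KLR algebra itself, cellularity (the cell datum,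
the anti-involution), graded Specht modules and graded decomposition numbers, the general
cyclotomic case `H_n^Λ` (any level, any quantum characteristic `e`).

Design. The degree is defined on raw growth sequences `Fin n → ℕ × ℕ`, so that it evaluates by
`decide` and needs no shape argument; the candidate addable nodes of a finite set `μ` are
`(0,0)` and the cells just below / just right of a cell of `μ` (`mem_addableNodes`: this list is
exhaustive), so no bounding window is involved. The `ℕ`-subtractions in `IsAddableNode` are
guarded by the disjuncts `x.1 = 0` / `x.2 = 0`. Used by the line `klr-graded-polynomial-method` of
`SnSubsetDichotomy.NoThresholdSubsetTriple` (MatrixMultiplication).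

## References

* J. Brundan, A. Kleshchev, *Blocks of cyclotomic Hecke algebras and Khovanov–Lauda algebras*,
  Invent. Math. 178 (2009) 451–484, arXiv:0808.2032, Main Theorem (the isomorphism
  `R_n^Λ ≅ H_n^Λ`, degenerate case with `e = char F`). [BrundanKleshchev2009]
* J. Hu, A. Mathas, *Graded cellular bases for the cyclotomic Khovanov–Lauda–Rouquier algebras of
  type A*, Adv. Math. 225 (2010) 598–642, arXiv:0907.2985, Main Theorem (§5: the basis
  `ψ_{ST} = ψ_{d(S)}^* e_λ y_λ ψ_{d(T)}`, homogeneous of degree `deg S + deg T`). [HuMathas2010]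
* J. Brundan, A. Kleshchev, W. Wang, *Graded Specht modules*, J. reine angew. Math. 655 (2011)
  61–87, arXiv:0901.0218, §3 (residues, addable and removable nodes, `d_A(λ)`, the degree of a
  standard tableau). [BrundanKleshchevWang2011]
* G. James, A. Kerber, *The Representation Theory of the Symmetric Group* (1981), §2.7
  (`p`-cores, `p`-residues and `p`-contents), 6.1.21 (Nakayama's conjecture). [JamesKerber1981]
-/

namespace Literature.RepresentationTheory.FiniteGroups

open Literature.NumberTheory.DiophantineGeometry (StdFilling numStandardTableaux)

/-! ### Residues, addable and removable nodes -/

/-- The `p`-residue of the cell `x = (row, col)` (0-based, English convention): `col - row`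
reduced mod `p` (James–Kerber §2.7; Brundan–Kleshchev–Wang 2011, §3, `res A`). For `p = 0` this is
the integer content `col - row`. [folklore] -/
def cellResidue (p : ℕ) (x : ℕ × ℕ) : ZMod p :=
  (x.2 : ZMod p) - (x.1 : ZMod p)

/-- `x` is an *addable node* of the finite set of cells `μ` (a Young diagram): `x ∉ μ`, and `x` is
supported from above (`x` is in row `0` or the cell above it lies in `μ`) and from the left (`x`
is in column `0` or the cell to its left lies in `μ`); for a Young diagram `μ` these are exactly
the cells whose addition gives a Young diagram. The `ℕ`-subtractions are guarded by the
disjuncts. Brundan–Kleshchev–Wang 2011, §3. [folklore] -/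
def IsAddableNode (μ : Finset (ℕ × ℕ)) (x : ℕ × ℕ) : Prop :=
  x ∉ μ ∧ (x.1 = 0 ∨ (x.1 - 1, x.2) ∈ μ) ∧ (x.2 = 0 ∨ (x.1, x.2 - 1) ∈ μ)

/-- `x` is a *removable node* of the finite set of cells `μ` (a Young diagram): `x ∈ μ` and
neither the cell below `x` nor the cell to the right of `x` lies in `μ`; for a Young diagram these
are the cells whose removal leaves a Young diagram. Brundan–Kleshchev–Wang 2011, §3. [folklore] -/
def IsRemovableNode (μ : Finset (ℕ × ℕ)) (x : ℕ × ℕ) : Prop :=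
  x ∈ μ ∧ (x.1 + 1, x.2) ∉ μ ∧ (x.1, x.2 + 1) ∉ μ

/-- Being an addable node is decidable (a Boolean combination of memberships). [folklore] -/
instance IsAddableNode.instDecidable (μ : Finset (ℕ × ℕ)) (x : ℕ × ℕ) :
    Decidable (IsAddableNode μ x) :=
  inferInstanceAs
    (Decidable (x ∉ μ ∧ (x.1 = 0 ∨ (x.1 - 1, x.2) ∈ μ) ∧ (x.2 = 0 ∨ (x.1, x.2 - 1) ∈ μ)))

/-- Being a removable node is decidable (a Boolean combination of memberships). [folklore] -/
instance IsRemovableNode.instDecidable (μ : Finset (ℕ × ℕ)) (x : ℕ × ℕ) :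
    Decidable (IsRemovableNode μ x) :=
  inferInstanceAs (Decidable (x ∈ μ ∧ (x.1 + 1, x.2) ∉ μ ∧ (x.1, x.2 + 1) ∉ μ))

/-- The finite set of addable nodes of `μ`: every addable node is `(0, 0)`, or the cell just below
a cell of `μ`, or the cell just right of a cell of `μ` (`mem_addableNodes`), so filtering these
candidates is exhaustive. [folklore] -/
def addableNodes (μ : Finset (ℕ × ℕ)) : Finset (ℕ × ℕ) :=
  (insert (0, 0) (μ.image (fun c => (c.1 + 1, c.2)) ∪ μ.image (fun c => (c.1, c.2 + 1)))).filter
    fun x => IsAddableNode μ x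

/-- The finite set of removable nodes of `μ`. [folklore] -/
def removableNodes (μ : Finset (ℕ × ℕ)) : Finset (ℕ × ℕ) :=
  μ.filter fun x => IsRemovableNode μ x

/-- `addableNodes μ` is exactly the set of addable nodes of `μ` (the candidate list is
exhaustive). [folklore] -/
theorem mem_addableNodes {μ : Finset (ℕ × ℕ)} {x : ℕ × ℕ} :
    x ∈ addableNodes μ ↔ IsAddableNode μ x := by
  rw [addableNodes, Finset.mem_filter, and_iff_right_iff_imp]
  obtain ⟨r, c⟩ := x
  rintro ⟨-, h₁, h₂⟩
  dsimp only at h₁ h₂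
  rcases Nat.eq_zero_or_pos r with hr | hr
  · rcases Nat.eq_zero_or_pos c with hc | hc
    · subst hr; subst hc; exact Finset.mem_insert_self _ _
    · refine Finset.mem_insert_of_mem (Finset.mem_union_right _ (Finset.mem_image.2 ?_))
      exact ⟨(r, c - 1), h₂.resolve_left (by omega), Prod.ext rfl (by show c - 1 + 1 = c; omega)⟩
  · refine Finset.mem_insert_of_mem (Finset.mem_union_left _ (Finset.mem_image.2 ?_))
    exact ⟨(r - 1, c), h₁.resolve_left (by omega), Prod.ext (by show r - 1 + 1 = r; omega) rfl⟩

/-- `removableNodes μ` is exactly the set of removable nodes of `μ`. [folklore] -/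
theorem mem_removableNodes {μ : Finset (ℕ × ℕ)} {x : ℕ × ℕ} :
    x ∈ removableNodes μ ↔ IsRemovableNode μ x := by
  rw [removableNodes, Finset.mem_filter, and_iff_right_iff_imp]
  exact fun h => h.1

/-! ### The Brundan–Kleshchev–Wang degree of a standard tableau -/

section Degree

variable {n : ℕ}

/-- The shape of the sub-tableau of the entries `0, …, k` of a tableau given by its growth
sequence `f` (`f j` = the cell of the entry `j`): the cells `f j`, `j ≤ k`. [folklore] -/
def prefixCells (f : Fin n → ℕ × ℕ) (k : Fin n) : Finset (ℕ × ℕ) :=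
  (Finset.univ.filter fun j : Fin n => j ≤ k).image f

/-- **The Brundan–Kleshchev–Wang degree increment** at the entry `k` of a tableau with growth
sequence `f`: with `A = f k` the cell of the entry `k`, `μ = prefixCells f k` the shape of the
entries `≤ k` (it contains `A`) and `i = res A`,
`d_A(μ) = #{addable i-nodes of μ strictly below A} − #{removable i-nodes of μ strictly below A}`,
"below" meaning a larger row index (Brundan–Kleshchev–Wang, Crelle 655 (2011), §3: `d_A(λ)`).
[cite: BrundanKleshchevWang2011, §3 (degree of a standard tableau)] -/
def tableauDegreeStep (p : ℕ) (f : Fin n → ℕ × ℕ) (k : Fin n) : ℤ :=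
  (((addableNodes (prefixCells f k)).filter fun B =>
        cellResidue p B = cellResidue p (f k) ∧ (f k).1 < B.1).card : ℤ) -
    (((removableNodes (prefixCells f k)).filter fun B =>
        cellResidue p B = cellResidue p (f k) ∧ (f k).1 < B.1).card : ℤ)

/-- **The Brundan–Kleshchev–Wang `p`-degree of a standard tableau** given by its growth sequence
`f : Fin n → ℕ × ℕ` (for a standard Young tableau `T : StdFilling n μ.youngDiagram` of the tree,
take `f = T.1`): `deg T = ∑_k d_{A_k}(shape T_{≤ k})`, an integer of either sign
(Brundan–Kleshchev–Wang, Crelle 655 (2011), §3, `deg(T) = deg(T_{≤ n-1}) + d_A(λ)`; Hu–Mathas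
2010 use the same degree). [cite: BrundanKleshchevWang2011, §3 (degree of a standard tableau)] -/
def tableauDegree (p : ℕ) (f : Fin n → ℕ × ℕ) : ℤ :=
  ∑ k : Fin n, tableauDegreeStep p f k

/-- Sanity value (`p = 2`): the one-row tableau `0 1` of shape `(2)` has degree `1` (the addable
node `(1,0)` below the entry `1` has its residue). [folklore] -/
theorem tableauDegree_two_row : tableauDegree 2 ![(0, 0), (0, 1)] = 1 := by
  decide

/-- Sanity value (`p = 2`): the one-column tableau `0 / 1` of shape `(1,1)` has degree `0`; with
`tableauDegree_two_row`, `dim_q 𝔽₂S₂ = q² + 1`, the graded dimension of `𝔽₂[y]/(y²)`,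
`deg y = 2`. [folklore] -/
theorem tableauDegree_two_col : tableauDegree 2 ![(0, 0), (1, 0)] = 0 := by
  decide

/-- Sanity value (`p = 2`, shape `(2,1)`): the tableau `0 1 / 2` has degree `1`. [folklore] -/
theorem tableauDegree_two_hook₁ : tableauDegree 2 ![(0, 0), (0, 1), (1, 0)] = 1 := by
  decide

/-- Sanity value (`p = 2`, shape `(2,1)`): the tableau `0 2 / 1` has degree `-1` (the removable
node `(1,0)` below the entry `2` has its residue); so the defect-`0` block of `(2,1)` has
`dim_q = (q + q⁻¹)²`. [folklore] -/
theorem tableauDegree_two_hook₂ : tableauDegree 2 ![(0, 0), (1, 0), (0, 1)] = -1 := by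
  decide

end Degree

/-! ### Residue content and same-shape pairs of standard tableaux -/

/-- The `p`-content of a partition `μ ⊢ n`: the number of cells of `μ.youngDiagram` of each
`p`-residue `i`. Two partitions of `n` have the same `p`-content iff they have the same `p`-core
(James–Kerber §2.7), iff they label the same `p`-block of `S_n` (Nakayama's conjecture, the
Brauer–Robinson theorem, James–Kerber 6.1.21); in the KLR algebra the content `α = ∑ αᵢ` labels
the summand `R_α^Λ = e_α R_n^Λ`. [folklore] -/
def residueContent (p : ℕ) {n : ℕ} (μ : Nat.Partition n) (i : ZMod p) : ℕ :=
  (μ.youngDiagram.cells.filter fun c => cellResidue p c = i).card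

/-- **Same-shape pairs of standard Young tableaux with `n` cells**, `Σ μ ⊢ n, Std(μ) × Std(μ)`
(`StdFilling n μ.youngDiagram` = the standard Young tableaux of shape `μ`, entries `0, …, n-1`):
the index set of the Murphy basis and of the Hu–Mathas graded cellular basis `{ψ_{ST}}` of
`K[S_n]`. There are `∑_μ (f^μ)² = n!` of them (tree: `sum_sq_numStandardTableaux`,
`numStandardTableaux_eq_card_stdFilling`); a finite type. [folklore] -/
abbrev TableauPair (n : ℕ) : Type :=
  Σ μ : Nat.Partition n, StdFilling n μ.youngDiagram × StdFilling n μ.youngDiagram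

/-- The degree of the Hu–Mathas basis vector `ψ_{ST}`: `deg S + deg T` (Hu–Mathas 2010, Main
Theorem), `deg` the Brundan–Kleshchev–Wang `p`-degree `tableauDegree`. [folklore] -/
def TableauPair.degree (p : ℕ) {n : ℕ} (x : TableauPair n) : ℤ :=
  tableauDegree p x.2.1.1 + tableauDegree p x.2.2.1

/-- The block label of the Hu–Mathas basis vector `ψ_{ST}`, `S, T` of shape `μ`: the `p`-content
of `μ` (`residueContent`). [folklore] -/
def TableauPair.content (p : ℕ) {n : ℕ} (x : TableauPair n) : ZMod p → ℕ :=
  residueContent p x.1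

/-! ### The named fact -/

/-- **Brundan–Kleshchev 2009 / Hu–Mathas 2010 / Brundan–Kleshchev–Wang 2011 — the graded cellular
basis of `𝔽_p S_n`.** For every prime `p` and every `n`, the group algebra `𝔽_p[S_n]` — the
level-one degenerate cyclotomic Hecke algebra `H_n^{Λ₀}`, isomorphic by Brundan–Kleshchev
(Invent. Math. 178 (2009), Main Theorem) to the cyclotomic Khovanov–Lauda–Rouquier algebra
`R_n^{Λ₀}` of type `A^{(1)}_{p-1}` over `𝔽_p` and thereby `ℤ`-GRADED — has a basis `{ψ_{ST}}`
indexed by the pairs `(S, T)` of standard Young tableaux of the same shape `λ ⊢ n` (Hu–Mathas,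
Adv. Math. 225 (2010), Main Theorem: `{ψ_{ST} = ψ*_{d(S)} e_λ y_λ ψ_{d(T)}}` is a homogeneous
graded cellular basis) such that each `ψ_{ST}` is homogeneous of degree `deg S + deg T`, `deg` the
Brundan–Kleshchev–Wang degree of a standard tableau (Crelle 655 (2011), §3; `tableauDegree`), and
lies in `e_α R_n^{Λ₀} e_α` for the content `α` of `λ` (`e(i) ψ_{ST} = δ_{i,i^S} ψ_{ST}`; the
`e_α = ∑_{i ∈ I^α} e(i)` are orthogonal central idempotents summing to `1`, and `e_α 𝔽_pS_n` is the
`p`-block of the partitions of `p`-content `α`). CONSEQUENCE RECORDED HERE (the only form used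
downstream), transported to `MonoidAlgebra (ZMod p) (Equiv.Perm (Fin n))` along the
Brundan–Kleshchev isomorphism: there is a basis `β` indexed by `TableauPair n` such that `β_i β_j`
lies in the span of the `β_k` with the same `p`-content as `i` and as `j` and with
`degree k = degree i + degree j` — across two different contents the right-hand side is
`span ∅ = 0`, as it must be (`e_α e_α' = 0`); within one content it is the homogeneity of the
product in the graded algebra `e_α R e_α`, whose homogeneous basis is `{ψ_k : content k = α}`.
Named fact, nothing asserted; formalising the proof (the KLR presentation of `𝔽_p S_n`, graded
cellularity) is far beyond the tree.
-- TODO(general form): the theorems hold for all cyclotomic Hecke algebras `H_n^Λ` (any level,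
-- degenerate or not, quantum characteristic `e`, multipartitions and multicharge residues), and
-- give a graded CELLULAR structure (cell modules = graded Specht modules); only level one,
-- degenerate, `e = p`, and only the multiplicativity in (content, degree) are recorded.
[cite: HuMathas2010, Main Theorem] -/
def KLRGradedCellularBasis : Prop :=
  ∀ (p : ℕ) [Fact p.Prime] (n : ℕ),
    ∃ β : Module.Basis (TableauPair n) (ZMod p) (MonoidAlgebra (ZMod p) (Equiv.Perm (Fin n))),
      ∀ i j : TableauPair n,
        β i * β j ∈ Submodule.span (ZMod p)
          (β '' {k | TableauPair.content p k = TableauPair.content p i ∧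
                     TableauPair.content p k = TableauPair.content p j ∧
                     TableauPair.degree p k = TableauPair.degree p i + TableauPair.degree p j})

end Literature.RepresentationTheory.FiniteGroups
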